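import Summits.CriticalPhenomena.SAWScalingLimit.Theses.SAWLeftRightFKG
import Literature.Probability.RandomPlanarGeometry.EdgeFugacitySAW

/-!
# Line `kesten-loop-towers` for crux `SAWLeftRightFKG.LeftRightFKG` (stmt-CriticalPhenomena-11232)

Skeleton (crux-plan, planner-cruxplan-stmt-CriticalPhenomena-11232-kesten-loop-towers-0, 2026-08-16) of
idea card `Cruxes/LeftRightFKG/Ideas/kesten-loop-towers.md` (crux-ideate r1 ideator 1; triage r1-1: **pass**),
lined — as the triage panel recommends — as ONE skeleton with the companion card `corner-localisation`
(its fugacity-blind reduction is `stub_reduction`), and with both triage sharpenings built in: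
(a) the circular clause "`R_good ≥ −Σ_disjoint`" of the card's transfer is replaced by the STRUCTURAL
transport bound `stub_transport` (`R_good + ½·Σ_disjoint ≥ 0`, i.e. `|R_good| ≤ ½ Σ_disjoint` on the
relevant side; data: `|R_good|/Σ_disjoint ≤ 1.4·10⁻³` on every box/band computed); (b) the `x ≤ x_c`
content is isolated in exactly two stubs (`stub_corewise`, `stub_transport`) stated for the capped
edge-weighted class, everything else being fugacity-free finite combinatorics / planar topology.

THE LINE. An INSTANCE (`Inst`) is the crux's own data at mesh 1 — a closed lattice walk `C` of `ℤ²`,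
the enclosed sites `encl C = {v | wind(C, v) ≠ 0}`, endpoints `a, b` lattice-adjacent to `C` — together
with a symmetric edge weight `0 ≤ y` (Grimmett–Li weighted SAW, `SAW.edgeFugacityWeight`; `y ≡ x_c` is the
crux, `y(e) = 0` emulates a deleted boundary edge, needed by the reduction). Chords are the SAWs of `ℤ²`
from `a` to `b` through `encl C` (`SAW.RestrictedSAW`), ordered left–right by `lrLE` (lens-loop winding
`≥ 0`, verbatim the crux's `le`). For a first-step up-set `A` and a last-step up-set `B` the corner
covariance is `w(univ)w(A∩B) − w(A)w(B) = det := Σ_{ordered pairs P=(α,β)} sgn(P)·w(α)w(β)`,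
`sgn = +1` on NESTED pairs (`α ∈ A∩B, β ∈ Aᶜ∩Bᶜ`), `−1` on CROSSED pairs (`α ∈ A∖B, β ∈ B∖A`), `0` else.
FIRST-MEETING SURGERY (generic graph theory, `firstMeet/peelWalks/peel/core`): `p` = first interior vertex
of `α` on `β`, `r` = first interior vertex of `β` on `α`; DISJOINT (`p, r` absent), GOOD (`p = r`), BAD
(`p ≠ r`); a bad pair peels to `ρ(α,β) = (α[a,p]·β[p,b], β[a,r]·α[r,b])` — two SAWs again, end-edge classes
swapped, the closed walk `α[p,r]·β[r,p]` (≥ 2 edges) excised, weight factorised; iterating `ρ` gives the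
CORE `core P`, which is disjoint or good. Hence, instance by instance,
`det = D + R`, `D := Σ_{P : core P disjoint} sgn·w` (`= Σ_{disjoint cores c} x^{|c|}·(E₀−E₁+E₂−…)(c)`,
the alternating loop-tower series of the card), `R := Σ_{P : core P good} sgn·w` (`R_good`; its tower-free
part cancels exactly under the single-switch involution).
* `stub_reduction` (card corner-localisation, fugacity-blind, CAPPED instancewise form demanded by triage):
  `CornerDet ycap → PALe ycap` for every pointwise cap `ycap` — corner covariances `≥ 0` throughout the class
  `{0 ≤ y ≤ ycap}` (closed under zeroing an edge and splicing a backtrack into `C`) give positive association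
  throughout the class (first/last-step splitting + endpoint monotonicity + two-point Chebyshev; induction
  on the number of positive-weight edges).
* `stub_carrier`: `PALe x_c → LeftRightFKG` (mesh scaling of `wind`, `encl C` at mesh 1 ↔ the crux's
  `Ω`-sites / largest component `meshDomain`, `RestrictedSAW ↔ DomainSAW`, `dartWeight_const`; plus the
  finiteness of `encl C`, a field of `Inst`).
* `stub_comparable` (planarity, used once): two internally disjoint chords of `ℤ²` are `lrLE`-comparable
  (their lens is a rectilinear Jordan polygon: `wind ∈ {0, +1}` or `{0, −1}`); so a CROSSED pair meets and
  a disjoint core is never crossed.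
* `stub_peel` (generic simple graph): validity / class swap / length drop / weight factorisation of `ρ`.
* `stub_corewise` (OPEN CONTENT, hardest): at `0 ≤ y ≤ x_c`, every disjoint non-crossed core `c` has
  fibre `Σ_{P : core P = c} sgn(P)·w(P) ≥ 0` (corewise positivity of the alternating tower series).
* `stub_transport` (open, triage sharpening (a)): at `0 ≤ y ≤ x_c`, `R + D/2 ≥ 0`.
* `LeftRightFKG_of` — the kernel-checked composition: `det = D + R` (trichotomy + termination of `ρ` from
  `stub_peel`), `D = Σ_c [c disjoint]·fibre(c) ≥ 0` (`stub_corewise` + `stub_comparable`), `R ≥ −D/2`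
  (`stub_transport`), so `CornerDet x_c`; then `stub_reduction`, `stub_carrier`.

Disproof.lean: none exists for this crux at planning time (payload `disproof_path` absent on disk;
`ledger crux ls stmt-CriticalPhenomena-11232` lists Ideas/, SketchIdeator1.lean, NegativeNotes, TRIAGE-r1-1.md
only), so no `_false_without_<H>` theorem is on record and no `Theorems/LeftRightFKG/Negative/*` lemma has
landed. The stub set answers instead to the refuter crux-attack on the item (EVIDENCE.md 2026-08-15T17:47Z):
adjacency of the endpoints to `C` is kept in `Inst` (necessary: interior endpoints kill PA at every
fugacity), nothing is claimed for `x > x_c` (`NotFKGAtOne`; on the 5×4-vertex box at `x = 1`: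
`D = +1536`, `R = −2464`), and the first-to-fail corner family is exactly what `CornerDet` quantifies.
Negatives index: stmt-0772 (all-δ tightness), stmt-8261 (Hadamard-power infinite divisibility) — unrelated.
Toy validation of the DEFINITIONS typed below (this seat, `toys/towers.py`, pure python, exact enumeration,
all ordered signed pairs): 4×4-vertex box `det = D = 1.2219·10⁻⁴`, `R = 0`, 42 disjoint cores, 0 negative
fibres; 5×4: `det = 4.4668·10⁻⁵ = D + R`, `D = 4.4674·10⁻⁵`, `R = −6.04·10⁻⁹`, 205 cores, 0 negative;
every assertion of `stub_peel`/`stub_comparable` (r after p on α, validity, class swap, length drop,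
disjoint core ⇒ nested, `sgn(P) = (−1)^{height}`) holds on all 4 264 / 118 056 / 9 056 968 signed pairs
(4×4 / 5×4 / 5×5 vertices; 5×5: `det = 2.3591·10⁻⁵`, `D = 2.3597·10⁻⁵`, `R = −6.14·10⁻⁹`, 1 799 cores,
0 negative, min alternating sum `.2552`); random inhomogeneous `y ∈ [0,x_c]^E` (300 / 300 / 40 trials) and
random `{0,x_c}`-valued `y` (97 / 99 / 16 non-degenerate trials): 0 violations of `stub_corewise` /
`stub_transport` / `CornerDet`.
-/

namespace Summit.CriticalPhenomena.SAWScalingLimit.Cruxes.LeftRightFKG.KestenLoopTowers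

open MeasureTheory
open Literature.Probability.LatticeModels Literature.Probability.RandomPlanarGeometry
open Summit.CriticalPhenomena.SAWScalingLimit.Theses

set_option linter.unusedVariables false
set_option linter.dupNamespace false

noncomputable section

/-! ## 1. First-meeting surgery on pairs of self-avoiding walks (generic simple graph) -/

section Surgery

variable {V : Type*} [DecidableEq V] {G : SimpleGraph V} {S : Set V} {a b : V}

/-- The FIRST MEETING of `α` with `β`: the first interior vertex of `α` (in order from `a`; interior =
`≠ a, b`) lying on `β`; `none` if the two walks are internally disjoint. -/
def firstMeet (α β : G.Walk a b) : Option V :=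
  α.support.tail.find? fun v => decide (v ≠ b ∧ v ∈ β.support)

/-- Internally disjoint pair: no interior vertex of `α` lies on `β`. -/
def IsDisjointPair (α β : G.Walk a b) : Prop :=
  firstMeet α β = none

/-- GOOD pair: the first meeting of `α` with `β` is also the first meeting of `β` with `α` (`p = r`; the
single tail switch at `p` is then a weight-preserving, class-swapping involution). -/
def IsGoodPair (α β : G.Walk a b) : Prop :=
  ∃ p, firstMeet α β = some p ∧ firstMeet β α = some p

/-- BAD pair: both first meetings exist and differ (`p ≠ r`); these are the pairs the peel `ρ` acts on. -/
def IsBadPair (α β : G.Walk a b) : Prop :=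
  ∃ p r, firstMeet α β = some p ∧ firstMeet β α = some r ∧ p ≠ r

/-- The PEEL `ρ` on raw walks: with `p = firstMeet α β`, `r = firstMeet β α`, write
`α = α₁(a→p)·α₂(p→r)·α₃(r→b)`, `β = β₁(a→r)·β₂(r→p)·β₃(p→b)` and return `(α₁·β₃, β₁·α₃)` — the closed
walk `α₂·β₂` through `p` and `r` is excised. Junk value `(α, β)` when a first meeting is absent or a
membership guard fails (for a bad pair of paths no guard fails: `stub_peel`). -/
def peelWalks (α β : G.Walk a b) : G.Walk a b × G.Walk a b :=
  match firstMeet α β, firstMeet β α with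
  | some p, some r =>
    if hp : p ∈ α.support then
      if hr : r ∈ (α.dropUntil p hp).support then
        if hr' : r ∈ β.support then
          if hp' : p ∈ (β.dropUntil r hr').support then
            ((α.takeUntil p hp).append ((β.dropUntil r hr').dropUntil p hp'),
              (β.takeUntil r hr').append ((α.dropUntil p hp).dropUntil r hr))
          else (α, β)
        else (α, β)
      else (α, β)
    else (α, β)
  | _, _ => (α, β)

open Classical in
/-- The peel on pairs of SAWs through `S` (`SAW.RestrictedSAW G S a b`): the raw peel when the pair is
bad and the two peeled walks are again SAWs through `S` (always the case: `stub_peel`), the identity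
otherwise (so disjoint and good pairs are fixed). -/
def peel (P : SAW.RestrictedSAW G S a b × SAW.RestrictedSAW G S a b) :
    SAW.RestrictedSAW G S a b × SAW.RestrictedSAW G S a b :=
  if h : IsBadPair P.1.walk P.2.walk ∧
      ((peelWalks P.1.walk P.2.walk).1.IsPath ∧ ∀ v ∈ (peelWalks P.1.walk P.2.walk).1.support, v ∈ S) ∧
      ((peelWalks P.1.walk P.2.walk).2.IsPath ∧ ∀ v ∈ (peelWalks P.1.walk P.2.walk).2.support, v ∈ S)
  then (⟨(peelWalks P.1.walk P.2.walk).1, h.2.1⟩, ⟨(peelWalks P.1.walk P.2.walk).2, h.2.2⟩)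
  else P

/-- The CORE of a pair: peel until the pair is no longer bad (each peel removes `≥ 2` edges, so
`|α| + |β|` iterations suffice; `core_not_bad`). The number of peels performed is the tower height. -/
def core (P : SAW.RestrictedSAW G S a b × SAW.RestrictedSAW G S a b) :
    SAW.RestrictedSAW G S a b × SAW.RestrictedSAW G S a b :=
  peel^[P.1.walk.length + P.2.walk.length] P

theorem peel_of_not_bad {P : SAW.RestrictedSAW G S a b × SAW.RestrictedSAW G S a b}
    (h : ¬ IsBadPair P.1.walk P.2.walk) : peel P = P := by
  unfold peel
  split_ifs with h'
  · exact absurd h'.1 h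
  · rfl

theorem not_isDisjointPair_of_isGoodPair {α β : G.Walk a b} (h : IsGoodPair α β) :
    ¬ IsDisjointPair α β := by
  obtain ⟨p, hp, -⟩ := h
  intro hd
  rw [IsDisjointPair] at hd
  rw [hd] at hp
  cases hp

/-- For paths, "some interior vertex of `β` lies on `α`" forces "some interior vertex of `α` lies on `β`". -/
theorem firstMeet_ne_none_of_firstMeet_eq_some {α β : G.Walk a b} (hβ : β.IsPath) {r : V}
    (h : firstMeet β α = some r) : firstMeet α β ≠ none := by
  have hpred := List.find?_some h
  have hmem : r ∈ β.support.tail := List.mem_of_find?_eq_some h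
  simp only [decide_eq_true_eq] at hpred
  obtain ⟨hrb, hrα⟩ := hpred
  -- `r ≠ a`: the support of the path `β` is `a :: tail` without repetition
  have hra : r ≠ a := by
    intro hra
    have hnd := hβ.support_nodup
    rw [← SimpleGraph.Walk.cons_tail_support] at hnd
    exact (List.nodup_cons.1 hnd).1 (hra ▸ hmem)
  have hrtail : r ∈ α.support.tail := by
    have := hrα
    rw [← SimpleGraph.Walk.cons_tail_support, List.mem_cons] at this
    rcases this with h1 | h1
    · exact absurd h1 hra
    · exact h1
  have hrβ : r ∈ β.support := List.mem_of_mem_tail hmem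
  intro hnone
  rw [firstMeet, List.find?_eq_none] at hnone
  exact hnone r hrtail (by simpa using And.intro hrb hrβ)

theorem isGoodPair_of_not_disjoint_not_bad {α β : G.Walk a b} (hα : α.IsPath)
    (hd : ¬ IsDisjointPair α β) (hb : ¬ IsBadPair α β) : IsGoodPair α β := by
  rw [IsDisjointPair] at hd
  obtain ⟨p, hp⟩ := Option.ne_none_iff_exists'.1 hd
  have hd' : firstMeet β α ≠ none :=
    firstMeet_ne_none_of_firstMeet_eq_some (α := β) (β := α) hα hp
  obtain ⟨r, hr⟩ := Option.ne_none_iff_exists'.1 hd'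
  by_cases hpr : p = r
  · subst hpr
    exact ⟨p, hp, hr⟩
  · exact absurd ⟨p, r, hp, hr, hpr⟩ hb

/-- An internally disjoint pair shares only the endpoints. -/
theorem eq_or_eq_of_isDisjointPair {α β : G.Walk a b} (h : IsDisjointPair α β) {v : V}
    (hvα : v ∈ α.support) (hvβ : v ∈ β.support) : v = a ∨ v = b := by
  by_cases hva : v = a
  · exact Or.inl hva
  · right
    have hvtail : v ∈ α.support.tail := by
      rw [← SimpleGraph.Walk.cons_tail_support, List.mem_cons] at hvα
      rcases hvα with h1 | h1
      · exact absurd h1 hva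
      · exact h1
    rw [IsDisjointPair, firstMeet, List.find?_eq_none] at h
    have := h v hvtail
    simp only [decide_eq_true_eq, not_and] at this
    by_contra hvb
    exact this hvb hvβ

end Surgery

/-! ## 2. Instances: the crux's lattice domains at mesh 1 with capped symmetric edge weights -/

/-- The lattice sites ENCLOSED by the closed lattice walk `C` (winding number `≠ 0` of its unit-mesh
polyline): the vertex set of the crux's discrete domain `Ω = {z | wind(C, z) ≠ 0}` at mesh `1`
(vertices on the trace have the junk value `wind = 0` and are excluded, as in the crux). -/
def encl {c : Site 2} (C : (zdGraph 2).Walk c c) : Set (Site 2) :=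
  {v | Literature.Topology.PlaneTopology.wind
        (fun t : ℝ => Set.IccExtend zero_le_one (C.toCurve (meshPoint 1)) t - meshPoint 1 v) ≠ 0}

/-- The LEFT–RIGHT order of two chords of `ℤ²` with common endpoints: the lens loop `γ₁ · γ₂⁻¹` has
winding `≥ 0` about every point — verbatim the crux's `le`, at mesh `1`. -/
def lrLE {a b : Site 2} (γ₁ γ₂ : (zdGraph 2).Walk a b) : Prop :=
  ∀ z : ℂ, 0 ≤ Literature.Topology.PlaneTopology.wind
    (fun t : ℝ => Set.IccExtend zero_le_one ((γ₁.append γ₂.reverse).toCurve (meshPoint 1)) t - z)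

/-- Chords: self-avoiding walks of `ℤ²` from `a` to `b` through the site set `S`
(`SAW.RestrictedSAW`, the carrier of `SAW.edgeFugacityWeight`). -/
abbrev Chord (S : Set (Site 2)) (a b : Site 2) : Type :=
  SAW.RestrictedSAW (zdGraph 2) S a b

/-- An INSTANCE of the capped edge-weighted class: the crux's data at mesh `1` (closed boundary walk
`C`, endpoints `a, b` lattice-adjacent to vertices `a', b'` of `C`) with a symmetric nonnegative edge
weight `y` (Grimmett–Li weighted SAW; `y ≡ x_c` is the crux, `y e = 0` deletes the edge `e`), and the
finiteness of the enclosed site set (always true — `wind` vanishes off a disc containing `C` — recorded as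
a field so that every sum below is finite by `rfl`; `stub_carrier` discharges it). -/
structure Inst where
  c : Site 2
  a : Site 2
  b : Site 2
  a' : Site 2
  b' : Site 2
  C : (zdGraph 2).Walk c c
  y : Site 2 → Site 2 → ℝ
  mem_a' : a' ∈ C.support
  mem_b' : b' ∈ C.support
  adj_a : (zdGraph 2).Adj a a'
  adj_b : (zdGraph 2).Adj b b'
  y_nonneg : ∀ u v, 0 ≤ y u v
  y_symm : ∀ u v, y u v = y v u
  finite : (encl C).Finite

namespace Inst

/-- The site set of the instance. -/
abbrev S (I : Inst) : Set (Site 2) := encl I.C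

/-- The chords of the instance. -/
abbrev Ch (I : Inst) : Type := Chord I.S I.a I.b

/-- Ordered pairs of chords. -/
abbrev Pair (I : Inst) : Type := I.Ch × I.Ch

instance (I : Inst) : Finite I.Ch := by
  haveI : Finite I.S := I.finite.to_subtype
  infer_instance

instance (I : Inst) : Fintype I.Ch := Fintype.ofFinite _

/-- Pointwise cap on the edge weights (`ycap ≡ x_c`: the critical-or-subcritical class). -/
def Capped (I : Inst) (ycap : Site 2 → Site 2 → ℝ) : Prop :=
  ∀ u v, I.y u v ≤ ycap u v

/-- The weight `∏_{darts} y` of a chord (`SAW.dartWeight`). -/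
def wt (I : Inst) (γ : I.Ch) : ℝ :=
  SAW.dartWeight (zdGraph 2) I.y γ.walk

/-- The weight of an ordered pair of chords. -/
def pw (I : Inst) (P : I.Pair) : ℝ :=
  I.wt P.1 * I.wt P.2

/-- The weighted chord measure of the instance (`SAW.edgeFugacityWeight`). -/
abbrev μ (I : Inst) : Measure I.Ch :=
  SAW.edgeFugacityWeight (zdGraph 2) I.y I.S I.a I.b

/-- The core of a pair of chords of the instance (dot-notation alias of the generic `core`). -/
abbrev core (I : Inst) (P : I.Pair) : I.Pair :=
  KestenLoopTowers.core P

end Inst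

/-- `A` is an up-set of chords for the left–right order. -/
def IsUpSet {I : Inst} (A : Set I.Ch) : Prop :=
  ∀ γ₁ γ₂, lrLE γ₁.walk γ₂.walk → γ₁ ∈ A → γ₂ ∈ A

/-- `A` is determined by the first step of the chord (a corner event at `a`). -/
def FirstStepEvent {I : Inst} (A : Set I.Ch) : Prop :=
  ∀ γ₁ γ₂, γ₁.walk.getVert 1 = γ₂.walk.getVert 1 → (γ₁ ∈ A ↔ γ₂ ∈ A)

/-- `B` is determined by the last step of the chord (a corner event at `b`). -/
def LastStepEvent {I : Inst} (B : Set I.Ch) : Prop :=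
  ∀ γ₁ γ₂, γ₁.walk.reverse.getVert 1 = γ₂.walk.reverse.getVert 1 → (γ₁ ∈ B ↔ γ₂ ∈ B)

/-- NESTED ordered pair for `(A, B)`: `α` in both up-sets, `β` in neither. -/
def IsNested {I : Inst} (A B : Set I.Ch) (P : I.Pair) : Prop :=
  P.1 ∈ A ∧ P.1 ∈ B ∧ P.2 ∉ A ∧ P.2 ∉ B

/-- CROSSED ordered pair for `(A, B)`: `α ∈ A ∖ B`, `β ∈ B ∖ A`. -/
def IsCrossed {I : Inst} (A B : Set I.Ch) (P : I.Pair) : Prop :=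
  P.1 ∈ A ∧ P.1 ∉ B ∧ P.2 ∉ A ∧ P.2 ∈ B

open Classical in
/-- The sign of an ordered pair in the corner determinant: `+1` nested, `−1` crossed, `0` otherwise. -/
def sgn {I : Inst} (A B : Set I.Ch) (P : I.Pair) : ℝ :=
  if IsNested A B P then 1 else if IsCrossed A B P then -1 else 0

namespace Inst

/-- The CORNER DETERMINANT `det = w(A∩B)·w(Aᶜ∩Bᶜ) − w(A∖B)·w(B∖A) = w(univ)·w(A∩B) − w(A)·w(B)`
written as a signed sum over ordered pairs of chords. -/
def det (I : Inst) (A B : Set I.Ch) : ℝ :=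
  ∑ P : I.Pair, sgn A B P * I.pw P

open Classical in
/-- The FIBRE of a pair `c` (used for disjoint cores): the signed weight of all pairs whose core is `c` —
`x^{|c|}·(E₀ − E₁ + E₂ − …)(c)`, the alternating loop-tower series of the card. -/
def fibre (I : Inst) (A B : Set I.Ch) (c : I.Pair) : ℝ :=
  ∑ P : I.Pair, if I.core P = c then sgn A B P * I.pw P else 0

open Classical in
/-- `D = Σ_{P : core P internally disjoint} sgn(P)·w(P)` — the disjoint-core part of `det`. -/
def disjointSum (I : Inst) (A B : Set I.Ch) : ℝ :=
  ∑ P : I.Pair, if IsDisjointPair (I.core P).1.walk (I.core P).2.walk then sgn A B P * I.pw P else 0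

open Classical in
/-- `R = Σ_{P : core P good} sgn(P)·w(P)` — the good-core remainder `R_good` of the card (its tower-free
part vanishes under the single-switch involution). -/
def goodSum (I : Inst) (A B : Set I.Ch) : ℝ :=
  ∑ P : I.Pair, if IsGoodPair (I.core P).1.walk (I.core P).2.walk then sgn A B P * I.pw P else 0

end Inst

/-- POSITIVE ASSOCIATION throughout the capped class `{0 ≤ y ≤ ycap}`: for every instance and all
left–right up-sets `A, B`, `w(A)·w(B) ≤ w(univ)·w(A ∩ B)` (event form, as in the crux). -/
def PALe (ycap : Site 2 → Site 2 → ℝ) : Prop :=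
  ∀ I : Inst, I.Capped ycap → ∀ A B : Set I.Ch, IsUpSet A → IsUpSet B →
    I.μ A * I.μ B ≤ I.μ Set.univ * I.μ (A ∩ B)

/-- CORNER POSITIVITY throughout the capped class `{0 ≤ y ≤ ycap}`: for every instance, every first-step
up-set `A` and last-step up-set `B`, the corner determinant is `≥ 0`. -/
def CornerDet (ycap : Site 2 → Site 2 → ℝ) : Prop :=
  ∀ I : Inst, I.Capped ycap → ∀ A B : Set I.Ch, IsUpSet A → IsUpSet B →
    FirstStepEvent A → LastStepEvent B → 0 ≤ I.det A B

/-- CARRIER IDENTIFICATION (statement of `stub_carrier`, named so that only `LeftRightFKG_of` concludes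
the crux decl by name): positive association of the capped class at the constant cap `ycap ≡ x_c` implies
the crux `SAWLeftRightFKG.LeftRightFKG`. -/
def CarrierIdentification : Prop :=
  PALe (fun _ _ => SAW.criticalFugacity) → SAWLeftRightFKG.LeftRightFKG

/-! ## 3. The stubs -/

/-- **Stub 1 — corner localisation (card `corner-localisation`, fugacity-blind; capped instancewise form).**
For every pointwise cap `ycap`: if every instance of the class `{0 ≤ y ≤ ycap, y symmetric}` has nonnegative
corner determinants (first-step up-set `A` at `a` against last-step up-set `B` at `b`), then every instance
of the class is positively associated in the left–right order.
Why plausibly true: triage r1-1 re-derived the reduction by hand and found it correct —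
`PA(G) ⇐ PA(G − e_a) ∧ PA(G − a; s₁, b) ∧ M(G)` by the two-point Chebyshev step on up-set indicators, and
the endpoint monotonicity `M(G) : μ(·|Eᶜ) ≼ μ(·|E)` from `M_end(G − e_a) ∧ M(G − e_b) ∧ M(G − b; a, t₁)`
and `Cov(1_E, 1_F) ≥ 0` (a mixture of a ≼-increasing two-member family is monotone in the mixing weight);
both conditional pieces are again instances of the SAME capped class (`y(e_a) := 0`, resp. the boundary
walk spliced with the backtrack `a' → a → a'`, order `le` restricting verbatim), induction on the number of
positive-weight edges, base cases `P(E)P(Eᶜ) = 0`. `det ≥ 0 ⟺ Cov(1_A, 1_B) ≥ 0` is the expansion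
`w(univ)w(AB) − w(A)w(B) = w(AB)w(AᶜBᶜ) − w(ABᶜ)w(AᶜB)` (finite sums, `edgeFugacityWeight_apply`).
Degenerate instances (`a = b`, `a` on the trace, `≤ 1` usable edge) are trivial. Toy: Strassen max-flow
check of `M` on 3×3/4×3-face boxes (ideator, `lrfkg_germ.py`): exact for `x ≤ 0.5`, fails from `.53`
exactly where the corner determinant turns negative. Size L (measure-on-finite-type bookkeeping, the
conditioning identities = domain Markov property of `∏ y`, Chebyshev's sum inequality
`MonovaryOn.sum_mul_sum_le_card_mul_sum`, Abel summation). Same mathematical content as the sibling line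
`Lines/corner-localisation.lean` (stubs `stub_endpointMonotone` + `stub_chebyshev` with geometric inputs
`stub_stepMonotone`, `stub_domainMarkov`), which is stated over the crux's own carrier `SAW.DomainSAW (dom C δ)`
at a homogeneous fugacity with END-STEP RESTRICTIONS `restr Sa Sb` in place of zeroed edges; conversely this
line's `stub_corewise`/`stub_transport`/`stub_peel`/`stub_comparable` (+ a carrier transport) are a proof plan
for that line's hardest stub `stub_corner : Corner x_c` (end-step restrictions = `{0, x_c}`-valued `y` at the
edges of `a`, `b`, inside the capped class). -/
theorem stub_reduction : ∀ ycap : Site 2 → Site 2 → ℝ, CornerDet ycap → PALe ycap := by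
  sorry

/-- **Stub 2 — carrier identification.** Positive association of the capped class at the constant cap
`ycap ≡ x_c` implies the crux: given the crux's data `(δ, c, a, b, a', b', C)` and up-sets `A, B` of
`SAW.DomainSAW Ω δ a b`, (i) `δ` is immaterial (`wind` of the `δ`-scaled polyline about `z` = `wind` of the
unit polyline about `z/δ`, so the `Ω`-sites are `encl C`; for `δ ≤ 0` the statement trivialises as the
refuter's exact reading records), (ii) `discreteDomainGraph Ω δ` is `zdGraph 2` induced on the largest
component(s) `meshDomain Ω δ ⊆ encl C` (a unit lattice edge between two enclosed sites misses the trace,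
so `meshGraph` = induced `ℤ²`), hence `DomainSAW Ω δ a b` ≃ the chords through that component — either no
chord exists (both sides `0`) or `a`'s component is the relevant one and chords through `encl C` from `a`
stay in it automatically, (iii) `SAW.weight = edgeFugacityWeight` with `y ≡ x_c` transported along the
equivalence (`weight_singleton`, `dartWeight_const`), up-sets correspond (same `le`), (iv) `encl C` is
finite (`wind_sub_eq_zero_of_dist_le`, AnnulusArcs) and the `Inst` fields are the crux's hypotheses.
Why plausibly true: pure transport of definitions; the refuter's crux-attack note confirms each reading.
Size M (mesh-scaling lemma for `wind ∘ toCurve`, component bookkeeping of `meshDomain`, `Measure.map` along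
an `Equiv` of finite discrete types). -/
theorem stub_carrier : CarrierIdentification := by
  sorry

/-- **Stub 3 — internally disjoint chords are comparable (planarity, `d = 2`).** Two self-avoiding walks
of `ℤ²` from `a` to `b` sharing no interior vertex satisfy `γ₁ ≼ γ₂` or `γ₂ ≼ γ₁` in the left–right order.
Why plausibly true: for `γ₁ ≠ γ₂` the lens `γ₁ · γ₂⁻¹` is a SIMPLE closed rectilinear lattice polygon, a
Jordan loop whose winding number is `0` outside and constant `= ±1` inside (rectilinear Umlaufsatz
`IsLoop.cycTurn_eq = ±4` + `IsJordanLoop.mem_inside_iff_wind_ne_zero` / `mem_outside_iff_wind_eq_zero`,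
local constancy of `wind`), and reversing the lens negates `wind`; on the trace `wind` is the junk `0`.
Degenerate cases (`a = b`: both walks `nil`; `γ₁ = γ₂` = the edge `ab`) give `wind ≡ 0`. Consequence used
by the composition: a CROSSED pair (`α ∈ A∖B`, `β ∈ B∖A`, `A, B` up-sets) is `≼`-incomparable, hence
meets; so disjoint cores are never crossed (the card's "crossed pairs must meet", the tree's
`Percolation.exists_mem_support_of_crossing` being the rectangle version). Size M (PlaneTopology:
RectilinearUmlaufsatz, PolygonUmlaufsatz, JordanSweepParity; polyline = `Walk.toCurve`). -/
theorem stub_comparable :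
    ∀ {a b : Site 2} (γ₁ γ₂ : (zdGraph 2).Walk a b), γ₁.IsPath → γ₂.IsPath →
      (∀ v ∈ γ₁.support, v ∈ γ₂.support → v = a ∨ v = b) → lrLE γ₁ γ₂ ∨ lrLE γ₂ γ₁ := by
  sorry

/-- **Stub 4 — the peel lemma (generic simple graph; finite combinatorics of the card's `ρ`).** For a BAD
pair of SAWs through `S` (first meetings `p ≠ r`): `r` lies after `p` on `α` and `p` after `r` on `β`, the
peeled walks `α₁β₃`, `β₁α₃` are SAWs through `S` (so `peel` takes its first branch), the total length
drops by at least `2`, the first component keeps `α`'s first step and takes `β`'s last step, the second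
keeps `β`'s first step and takes `α`'s last step (CLASS SWAP: nested ↔ crossed for first-step/last-step
events), and the weight factorises through the excised closed walk `ℓ = α₂β₂` at `p` (`≥ 2` edges,
through `S`): `w(α)w(β) = w(α₁β₃)w(β₁α₃)·w(ℓ)` for every dart weight `y`.
Why plausibly true: `α₁ = α[a,p]` meets `β` only in `{a, p}` (minimality of `p`), `β₃ = β[p,b]` avoids `a`
(`β` is a path, `p ≠ a`), so `α₁β₃` is a path; symmetrically `β₁α₃`; `r ∈ α` is an interior vertex of `α`
on `β` hence not before `p`; `dartWeight_append`. Verified on all 4 264 / 118 056 signed pairs of the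
4×4- / 5×4-vertex boxes (this seat) and on 7.9·10⁸ pairs up to 6×5 plus a 311-case zoo (triage T3).
Size M (`Walk.takeUntil/dropUntil`, `count_support_takeUntil_eq_one`, `IsPath` of appends,
`List.find?_eq_some_iff_append` for minimality). -/
theorem stub_peel {V : Type*} [DecidableEq V] {G : SimpleGraph V} {S : Set V} {a b : V}
    (P : SAW.RestrictedSAW G S a b × SAW.RestrictedSAW G S a b) (hP : IsBadPair P.1.walk P.2.walk) :
    ((peel P).1.walk, (peel P).2.walk) = peelWalks P.1.walk P.2.walk ∧
    (peel P).1.walk.length + (peel P).2.walk.length + 2 ≤ P.1.walk.length + P.2.walk.length ∧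
    (peel P).1.walk.getVert 1 = P.1.walk.getVert 1 ∧
    (peel P).1.walk.reverse.getVert 1 = P.2.walk.reverse.getVert 1 ∧
    (peel P).2.walk.getVert 1 = P.2.walk.getVert 1 ∧
    (peel P).2.walk.reverse.getVert 1 = P.1.walk.reverse.getVert 1 ∧
    ∃ (p : V) (ℓ : G.Walk p p), p ∈ (peel P).1.walk.support ∧ p ∈ P.2.walk.support ∧ 2 ≤ ℓ.length ∧
      (∀ v ∈ ℓ.support, v ∈ S) ∧
      ∀ y : V → V → ℝ, SAW.dartWeight G y P.1.walk * SAW.dartWeight G y P.2.walk =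
        SAW.dartWeight G y (peel P).1.walk * SAW.dartWeight G y (peel P).2.walk * SAW.dartWeight G y ℓ := by
  sorry

/-- **Stub 5 — COREWISE POSITIVITY at `y ≤ x_c` (the open content of the line; HARDEST).** For every
instance with `0 ≤ y ≤ x_c`, every first-step up-set `A` and last-step up-set `B`, and every internally
disjoint, non-crossed pair `c`, the fibre `Σ_{P : core P = c} sgn(P)·w(P)` is `≥ 0`. For a disjoint NESTED
core this is `x^{|c|}·Σ_k (−1)^k E_k(c) ≥ 0`, `E_k(c)` the generating function of `k`-loop towers on `c`
(`sgn(P) = (−1)^{height}` by the class swap of `stub_peel`; `E₀ = 1`); for other classes the fibre is `0`.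
Why plausibly true: (tier i, where the data binds) the binding cores are maximal-contact pairs — adjacent
diagonal staircases, interleaved combs — whose towers are commuting length-2 rungs across a 2-wide
corridor, a one-dimensional heap with `Σ(−1)^k E_k = ∏(1 − x²·…) > 0` and threshold `≈ 0.44–0.455 > x_c`
for all `L` (triage: diagonal bands `L ≤ 8`, alt ≈ `C·0.61^L`; width-2 strip `det = x^{2M}(1−x²)^{M−2}`
exactly); only `x_c < 0.44`, i.e. `μ > 2.27` (`SAW.le_connectiveConstant_26`), is used there;
(tier ii) wide cores (boundary-hugging pairs): a single insertion is a PAIR of disjoint crossings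
`α₂ : p → r`, `β₂ : r → p` of the domain between the two chords, activity `≲ x^{|α₂|+|β₂|}` summed over
`p, r` — at `x = x_c` this is a product of two boundary-to-boundary two-point functions, finite and small
uniformly in `L` exactly because bridge/irreducible-bridge masses at `x_c` are bounded (Kesten:
`Σ_k λ_k x^k ≤ 1 ⟺ x ≤ x_c`, Madras–Slade (4.2.3)–(4.2.4); tree: `SAW.Renewal.le_connectiveConstant_of_kraft`,
`SAW.Zd.bridgeCount_le_pow`), and divergent for `x > x_c` (DKY), matching `x₀(L) ↓ x_c`; a Kotecký–Preiss /
heap-of-pieces bound then controls the alternating series. Data: 0 negative fibres among 42 / 205 / 1 799 /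
982 / 15 437 disjoint cores (boxes up to 6×5 vertices, 7.9·10⁸ pairs) and in a 311-case zoo of slits, holes,
dead edges at `x_c`; min alternating sum `.1034` (6×5 comb pair) `≈ (1 − x_c²)^{14}`; corewise thresholds
`.505/.48/.465/.475/.455` vs `x_c = .379`; this seat: 0 violations under 640 random inhomogeneous
`y ≤ x_c` and 212 random non-degenerate `{0, x_c}`-valued `y` (4×4, 5×4, 5×5 vertices).
Why it might fail: wide cores at large `L` are untested (their corewise threshold must descend towards
`x_c` like the det threshold `x_c + 0.91 L^{-4/3}`; if it undershoots, corewise positivity fails while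
`det ≥ 0` survives by cancellation between cores, and the line must regroup cores by the position of the
first macroscopic loop); inhomogeneous `y ≤ x_c` is extra exposure (repair: restrict `Inst.y` to
`{0, x_c}`-valued weights, a class still closed under the reduction). Size XL. -/
theorem stub_corewise :
    ∀ I : Inst, I.Capped (fun _ _ => SAW.criticalFugacity) →
      ∀ A B : Set I.Ch, IsUpSet A → IsUpSet B → FirstStepEvent A → LastStepEvent B →
        ∀ c : I.Pair, IsDisjointPair c.1.walk c.2.walk → ¬ IsCrossed A B c → 0 ≤ I.fibre A B c := by
  sorry

/-- **Stub 6 — GOOD-CORE TRANSPORT at `y ≤ x_c` (triage sharpening (a): the structural replacement of the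
card's circular clause `R_good ≥ −Σ_disjoint`).** For every instance with `0 ≤ y ≤ x_c` and every
first-step up-set `A`, last-step up-set `B`: `R + D/2 ≥ 0`, where `R = Σ_{P : core P good} sgn(P)w(P)` and
`D = Σ_{P : core P disjoint} sgn(P)w(P)`. (Any `θ < 1` in `R + θ·D ≥ 0` would serve the composition;
`θ = 1` is the corner inequality itself and is NOT what is asked.)
Why plausibly true: the pairs that ARE good (no tower) cancel exactly in `R` under the single tail switch
at `p = r` (a weight-preserving, class-swapping involution preserving goodness — the `k = 0` terms), so `R`
is the MISMATCH of towers between involution partners `c ↔ c*` (towers valid on `c` but not on `c*` differ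
only in which tail the first loop must avoid); a tower transport charging each mismatched tower to a tower
on a disjoint core obtained by one further switch is the intended proof. Data (triage + this seat):
`R/D = 0` (4×4 vertices), `−1.35·10⁻⁴` (5×4), `−2.6·10⁻⁴` (5×5), `−2.9·10⁻⁴` (6×4), `−4.3·10⁻⁴` (6×5),
`−2.7·10⁻⁴` (7×3); diagonal bands `{−2..2}`: `−4.2·10⁻⁴, −9.1·10⁻⁴, −1.4·10⁻³` (`L = 5, 6, 7`) — three
orders of magnitude inside the bound, but growing roughly linearly in `L` on bands.
Near the degenerate necklace weightings (where `det = 0` is attained in the edge-weighted class: diagonal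
diamond chain at `x_c`, all other edges `ε·x_c`, 5×5 vertices, 60-digit arithmetic) the disjoint part
carries everything: `det = D ∝ ε⁶`, `R ∝ ε⁸`, `R/D = −3.8·10⁻⁹` at `ε = 10⁻²` and `→ 0`.
Why it might fail: no mechanism yet forces `|R| ≤ D/2`, and `|R|/D` grows (slowly) with `L`; cheapest
falsifier: adversarial `{0,x_c}`-valued `y` on the 5×5/6×5-vertex boxes and the diagonal bands
`L ≤ 10` maximising `−R/D`. It is a genuine `x ≤ x_c` statement: at `x = 1` on 5×5 vertices
`det = +8.5·10⁴ > 0` but `D = 4.6·10⁵`, `R = −3.7·10⁵`, `R/D = −0.81 < −1/2`; on 5×4 vertices `D = +1536`,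
`R = −2464`. Size L–XL. -/
theorem stub_transport :
    ∀ I : Inst, I.Capped (fun _ _ => SAW.criticalFugacity) →
      ∀ A B : Set I.Ch, IsUpSet A → IsUpSet B → FirstStepEvent A → LastStepEvent B →
        0 ≤ I.goodSum A B + I.disjointSum A B / 2 := by
  sorry

/-! ## 4. The composition (kernel-checked; no `sorry` of its own) -/

section Composition

variable {V : Type*} [DecidableEq V] {G : SimpleGraph V} {S : Set V} {a b : V}

/-- Termination of the peel: after `n ≥ |α| + |β|` peels the pair is no longer bad (each peel of a bad
pair removes at least two edges, `stub_peel`; non-bad pairs are fixed). -/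
theorem iterate_peel_not_bad (n : ℕ) :
    ∀ P : SAW.RestrictedSAW G S a b × SAW.RestrictedSAW G S a b,
      P.1.walk.length + P.2.walk.length ≤ n →
        ¬ IsBadPair (peel^[n] P).1.walk (peel^[n] P).2.walk := by
  induction n with
  | zero =>
    intro P hP hbad
    simp only [Function.iterate_zero, id_eq] at hbad
    have h := (stub_peel P hbad).2.1
    omega
  | succ n ih =>
    intro P hP
    by_cases hbad : IsBadPair P.1.walk P.2.walk
    · rw [Function.iterate_succ_apply]
      apply ih
      have h := (stub_peel P hbad).2.1
      omega
    · rw [Function.iterate_fixed (peel_of_not_bad hbad) (n + 1)]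
      exact hbad

/-- Every core is disjoint or good (never bad). -/
theorem core_not_bad (P : SAW.RestrictedSAW G S a b × SAW.RestrictedSAW G S a b) :
    ¬ IsBadPair (core P).1.walk (core P).2.walk :=
  iterate_peel_not_bad _ P le_rfl

/-- `det = D + R`: every pair has a core, which is internally disjoint or good. -/
theorem det_eq_disjointSum_add_goodSum (I : Inst) (A B : Set I.Ch) :
    I.det A B = I.disjointSum A B + I.goodSum A B := by
  classical
  unfold Inst.det Inst.disjointSum Inst.goodSum
  rw [← Finset.sum_add_distrib]
  refine Finset.sum_congr rfl fun P _ => ?_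
  by_cases hd : IsDisjointPair (I.core P).1.walk (I.core P).2.walk
  · have hg : ¬ IsGoodPair (I.core P).1.walk (I.core P).2.walk :=
      fun hg => not_isDisjointPair_of_isGoodPair hg hd
    simp [hd, hg]
  · have hg : IsGoodPair (I.core P).1.walk (I.core P).2.walk :=
      isGoodPair_of_not_disjoint_not_bad (I.core P).1.isPath hd (core_not_bad P)
    simp [hd, hg]

/-- A disjoint pair of chords is not crossed for up-sets `A, B` (planarity via `stub_comparable`). -/
theorem not_isCrossed_of_isDisjointPair {I : Inst} {A B : Set I.Ch} (hA : IsUpSet A) (hB : IsUpSet B)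
    (c : I.Pair) (hc : IsDisjointPair c.1.walk c.2.walk) : ¬ IsCrossed A B c := by
  rintro ⟨h1A, h1B, h2A, h2B⟩
  rcases stub_comparable c.1.walk c.2.walk c.1.isPath c.2.isPath
      (fun v hv hv' => eq_or_eq_of_isDisjointPair hc hv hv') with h | h
  · exact h2A (hA _ _ h h1A)
  · exact h1B (hB _ _ h h2B)

open Classical in
/-- `D` is the sum over cores `c` of `[c disjoint]·fibre(c)`. -/
theorem disjointSum_eq_sum_fibre (I : Inst) (A B : Set I.Ch) :
    I.disjointSum A B =
      ∑ c : I.Pair, if IsDisjointPair c.1.walk c.2.walk then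
        (∑ P : I.Pair, if I.core P = c then sgn A B P * I.pw P else 0) else 0 := by
  classical
  unfold Inst.disjointSum
  have key : ∀ P : I.Pair,
      (if IsDisjointPair (I.core P).1.walk (I.core P).2.walk then sgn A B P * I.pw P else 0) =
        ∑ c : I.Pair, if I.core P = c then
          (if IsDisjointPair c.1.walk c.2.walk then sgn A B P * I.pw P else 0) else 0 := by
    intro P
    simp only [Finset.sum_ite_eq, Finset.mem_univ, if_true]
  simp_rw [key]
  rw [Finset.sum_comm]
  refine Finset.sum_congr rfl fun c _ => ?_
  by_cases hc : IsDisjointPair c.1.walk c.2.walk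
  · simp only [hc, if_true]
  · simp only [hc, if_false, ite_self, Finset.sum_const_zero]

/-- `D ≥ 0` from corewise positivity and planarity. -/
theorem disjointSum_nonneg (I : Inst) (hcap : I.Capped (fun _ _ => SAW.criticalFugacity))
    (A B : Set I.Ch) (hA : IsUpSet A) (hB : IsUpSet B) (hAf : FirstStepEvent A) (hBl : LastStepEvent B) :
    0 ≤ I.disjointSum A B := by
  classical
  rw [disjointSum_eq_sum_fibre]
  refine Finset.sum_nonneg fun c _ => ?_
  by_cases hc : IsDisjointPair c.1.walk c.2.walk
  · rw [if_pos hc]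
    have h := stub_corewise I hcap A B hA hB hAf hBl c hc (not_isCrossed_of_isDisjointPair hA hB c hc)
    unfold Inst.fibre at h
    exact h
  · rw [if_neg hc]

/-- **`LeftRightFKG` from the six stubs.** `det = D + R ≥ D/2 + (R + D/2) ≥ 0` at `y ≤ x_c` gives
`CornerDet x_c`; the reduction gives `PALe x_c`; the carrier identification gives the crux. -/
theorem LeftRightFKG_of : SAWLeftRightFKG.LeftRightFKG := by
  refine stub_carrier (stub_reduction (fun _ _ => SAW.criticalFugacity) ?_)
  intro I hcap A B hA hB hAf hBl
  rw [det_eq_disjointSum_add_goodSum]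
  have hD := disjointSum_nonneg I hcap A B hA hB hAf hBl
  have hT := stub_transport I hcap A B hA hB hAf hBl
  linarith

end Composition

end

end Summit.CriticalPhenomena.SAWScalingLimit.Cruxes.LeftRightFKG.KestenLoopTowers
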